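import Summits.ABC.IUTFork.LDHSplitBadPrimeRational
import Summits.ABC.IUTFork.LDHInitialThetaDataPerPacket
import HarnessLib

/-!
# The fork at [IUTchIII] Corollary 3.12, L-DH level: over `F_mod = ℚ` the bad-mass escape is void AT INITIAL Θ-DATA

Proof-only companion (D-0012; 0 definitions, no `Prop` fact) of `LDHSplitBadPrimeRational.lean` (p430803) and
`LDHSplitBadPrimeInitialThetaData.lean` (p431095), abc-iut-w5-d018 (gen 4). TAKES NO SIDE on [IUTchIII] Cor. 3.12.

`LDHSplitBadPrimeInitialThetaData` read the bad-mass TRUE side at initial Θ-data `D` through abc-iut-S2's genuine input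
`volumeInputOf D r`: chosen bad places carrying `≤ 1/2` of `[F_mod:ℚ]` over every support prime ⇒ `Cor312Of (volumeInputOf D r)`.
HERE the complementary record for the abc route: if `j_E ∈ ℚ` (so `F_mod = ℚ(j_E) = ℚ`, abc-iut-w5-d157's
`finrank_fieldOfModuli_eq_one_of_j_mem_range`), then for EVERY idele datum `r` the hypothesis of abc-iut-c312-3's
`cor312Of_of_badMass_le` FAILS for `volumeInputOf D r` (`not_badMass_condition_of_finrank_eq_one`: every bad prime is totally bad,
`(1/ℓ⋇)Σ(i+1)² > 1`) — Frey–Hellegouarch data get no place-combinatorial escape; over `ℚ` the sharp-model fork is decided by depth.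
Typed objects; no side taken; typed ≠ proved. [cite: Mochizuki2012, IUTchI Def. 3.1 (b) p. 61] [cite: DupuyHilado2025, §3.6]
[claim: Mochizuki2012, status: disputed]
-/

noncomputable section

open NumberField IsDedekindDomain Literature.IUT.LogVolume Literature.IUT.HodgeTheaters

namespace Summit.ABC.IUTFork

namespace InitialThetaData

variable {F K Fbar : Type} [Field F] [NumberField F] [Field K] [NumberField K] [Algebra F K]
  [Field Fbar] [Algebra F Fbar] [Algebra K Fbar] {E : WeierstrassCurve F} [E.IsElliptic] {l : ℕ}
  {Pb : BadPlacePredicates K} (D : Literature.IUT.HodgeTheaters.InitialThetaData F K Fbar E l Pb)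

/-- **Over `F_mod = ℚ` (`j_E ∈ ℚ`) the bad-mass condition fails for the genuine input of `D`, every idele datum** (every bad prime
totally bad; `(1/ℓ⋇)Σ_{i<ℓ⋇}(i+1)² > 1`). [claim: Mochizuki2012, status: disputed] [cite: Mochizuki2012, IUTchI Def. 3.1 (b) p. 61]
[cite: DupuyHilado2025, §3.6] -/
theorem not_badMass_condition_volumeInputOf_of_j_mem_range (hj : E.j ∈ Set.range (algebraMap ℚ F))
    (r : ThetaData.IdeleData D) :
    ¬ ∀ p ∈ (ThetaData.volumeInputOf D r).supportPrimes,
        (1 / ((ThetaData.volumeInputOf D r).lstar : ℝ)) * ∑ i : Fin (ThetaData.volumeInputOf D r).lstar,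
          (((i : ℕ) + 1 : ℝ) ^ 2) *
            (∑ v : placesOver (fieldOfModuli E) p,
              ((ThetaData.volumeInputOf D r).X.S : Set (HeightOneSpectrum (𝓞 (fieldOfModuli E)))).indicator
                (weight (fieldOfModuli E)) v.1) ^ ((i : ℕ) + 1) ≤ 1 :=
  not_badMass_condition_of_finrank_eq_one (finrank_fieldOfModuli_eq_one_of_j_mem_range hj) (ThetaData.volumeInputOf D r)

end InitialThetaData

end Summit.ABC.IUTFork

end
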